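import Summits.CriticalPhenomena.SAWScalingLimit.Theorems.SAWLoopFugacityFlowSimpleSubseqLimitsTransferLocal
import Summits.CriticalPhenomena.SAWScalingLimit.Theorems.SAWLoopFugacityFlowSimpleSubseqLimitsTransferConf
import Summits.CriticalPhenomena.SAWScalingLimit.Theorems.SAWLoopFugacityFlowSimpleSubseqLimitsPrefixTiming
import HarnessLib

/-!
# Line `slit-continuous-restriction` — the soft transfer, part 3: the lattice reading of the squeeze
# configuration (crux stmt-CriticalPhenomena-4982, decl
# `Summit.CriticalPhenomena.SAWScalingLimit.Theses.SAWLoopFugacityFlow.SimpleSubseqLimits`;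
# registered skeleton `Cruxes/SimpleSubseqLimits/Lines/slit_continuous_restriction.lean`)

Third file toward the registered stub `stub_transferCore` (lead c9). If the mesh polyline
`latticeCurve γ` of a lattice SAW `γ` (mesh `δ > 0`) is in the squeeze configuration
`Conf q ρ ρ₀ R ε N` with `ρ₀ + δ ≤ ρ`, then, with `k` the index of the FIRST vertex of `γ` in the
closed ball `B̄(q, ρ)`:
* the vertex time `1 - 2^{-k}` lies in the squeeze window `(τa, τb]` (the vertex nearest to the
  `ρ₀`-deep point `γ τb` is already `ρ`-close; before `τa` every polyline point is `ρ`-far), so the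
  class of the truncation at that time — which IS the class of the polyline of the prefix walk with
  `k + 1` vertices (`Timing.polyline_map_take_support` + a monotone-reparametrisation identity) — lies
  in `N`;
* some vertex of index `j ≥ k` (the vertex of the edge carrying the return time `t'`) is within
  `ε + δ` of a point of the `R`-far past of that truncation (namely of `γ v`).
This is exactly the membership in the event of the landed `Lattice.LatticeBound`
(`latticeEvent_of_conf`).
-/

noncomputable section

open MeasureTheory Filter Topology Set Metric Function
open Literature.Probability.RandomPlanarGeometry Literature.Probability.RandomPlanarGeometry.SAW
open Literature.Probability.LatticeModels
open scoped ENNReal NNReal unitInterval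

namespace Summit.CriticalPhenomena.SAWScalingLimit.Theorems.SimpleSubseqLimits.SlitRestriction.Transfer

open Summit.CriticalPhenomena.SAWScalingLimit.Theorems.SimpleSubseqLimits.MarkedPointRevisit.Passage
  (latticeCurve)
open Summit.CriticalPhenomena.SAWScalingLimit.Theorems.SimpleSubseqLimits.SlitRestriction.Pasts
  (truncate)
open Summit.CriticalPhenomena.SAWScalingLimit.Theorems.SimpleSubseqLimits.SlitRestriction.Timing
  (vertexTime vertexTime_mono vertexTime_le_one latticeCurve_vertexTime latticeCurve_one
    dist_latticeCurve_le polyline_map_take_support)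

/-! ## Dyadic bookkeeping -/

/-- Every parameter `t < 1` lies in a dyadic window `[1 - 2^{-l}, 1 - 2^{-(l+1)}]`, and `l` is the
largest index whose vertex time is `≤ t`. [folklore] -/
theorem exists_vertexTime_le : ∀ t : I, (t : ℝ) < 1 →
    ∃ l : ℕ, vertexTime l ≤ t ∧ t ≤ vertexTime (l + 1) ∧ ∀ k : ℕ, vertexTime k ≤ t → k ≤ l := by
  intro t ht
  have hex : ∃ l : ℕ, (t : ℝ) < (vertexTime (l + 1) : ℝ) := by
    obtain ⟨n, hn⟩ := exists_pow_lt_of_lt_one (sub_pos.2 ht) (by norm_num : (1 / 2 : ℝ) < 1)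
    refine ⟨n, ?_⟩
    change (t : ℝ) < 1 - (1 / 2) ^ (n + 1)
    have : (1 / 2 : ℝ) ^ (n + 1) ≤ (1 / 2) ^ n :=
      pow_le_pow_of_le_one (by norm_num) (by norm_num) (Nat.le_succ n)
    linarith
  classical
  refine ⟨Nat.find hex, ?_, Subtype.coe_le_coe.1 (Nat.find_spec hex).le, fun k hk => ?_⟩
  · rcases h0 : Nat.find hex with _ | m
    · exact Subtype.coe_le_coe.1 (by change (1 : ℝ) - (1 / 2) ^ 0 ≤ t; simpa using t.2.1)
    · have hm : ¬ (t : ℝ) < (vertexTime (m + 1) : ℝ) := Nat.find_min hex (by omega)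
      exact Subtype.coe_le_coe.1 (not_lt.1 hm)
  · by_contra hlt
    have h1 : Nat.find hex + 1 ≤ k := by omega
    have h2 := Subtype.coe_le_coe.2 ((vertexTime_mono h1).trans hk)
    exact absurd (Nat.find_spec hex) (not_lt.2 h2)

/-- The vertex time of an index is positive as soon as it exceeds some parameter. [folklore] -/
theorem vertexTime_pos_of_lt {τ : I} {k : ℕ} (h : τ < vertexTime k) : 0 < (vertexTime k : ℝ) :=
  lt_of_le_of_lt τ.2.1 (Subtype.coe_lt_coe.2 h)

/-! ## Truncations of the mesh polyline -/

/-- **The prefix polyline has the class of the truncation.** Composing a curve with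
`min · m` (run up to time `m`, then rest) and truncating-and-rescaling it at `m` are two monotone
continuous traversals of the same arc, hence have the same class
(`Curve.reparamDist_eq_zero_of_monotone'`). [folklore] -/
theorem mk_minCurve_eq_mk_truncate (c : Curve ℂ) (m : I) :
    CurveClass.mk (⟨⟨fun t : I => c (min t m), c.continuous.comp (continuous_id.min continuous_const)⟩⟩
      : Curve ℂ) = CurveClass.mk (truncate c m) := by
  rw [CurveClass.mk_eq_mk]
  have hcoe : ∀ t : I, ((min t m : I) : ℝ) = min (t : ℝ) (m : ℝ) := fun t =>
    (Subtype.mono_coe _).map_min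
  refine Curve.reparamDist_eq_zero_of_monotone' (m := (m : ℝ)) m.2.1
    (V := fun x => c (projIcc 0 1 zero_le_one x))
    (h₁ := fun x => min ((projIcc 0 1 zero_le_one x : I) : ℝ) (m : ℝ))
    (h₂ := fun x => (m : ℝ) * ((projIcc 0 1 zero_le_one x : I) : ℝ))
    (c.continuous.comp continuous_projIcc).continuousOn
    ((continuous_subtype_val.comp continuous_projIcc).min continuous_const)
    (continuous_const.mul (continuous_subtype_val.comp continuous_projIcc))
    (fun x y hxy => min_le_min_right _ (Subtype.coe_le_coe.2 (monotone_projIcc zero_le_one hxy)))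
    (fun x y hxy => mul_le_mul_of_nonneg_left
      (Subtype.coe_le_coe.2 (monotone_projIcc zero_le_one hxy)) m.2.1)
    (by simp [m.2.1]) (by simp) (by simp [m.2.2]) (by simp) (fun t => ?_) fun t => ?_
  · change c (min t m) = c (projIcc 0 1 zero_le_one (min ((projIcc 0 1 zero_le_one (t : ℝ) : I) : ℝ) m))
    rw [projIcc_val, ← hcoe, projIcc_val]
  · change c ⟨(m : ℝ) * t, _⟩ = c (projIcc 0 1 zero_le_one ((m : ℝ) * ((projIcc 0 1 zero_le_one (t : ℝ) : I) : ℝ)))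
    rw [projIcc_val, projIcc_of_mem zero_le_one (unitInterval.mul_mem m.2 t.2)]

/-- **A guarded early value lies in the far past of a later truncation**: if `v ≤ m`, `0 < m` and the
curve is `R`-far from `q` on `[0, v]`, then `c v` belongs to the `R`-far past of `c|[0, m]`.
[folklore] -/
theorem apply_mem_farPast_truncate {c : Curve ℂ} {v m : I} (hm : 0 < (m : ℝ)) (hvm : v ≤ m)
    {q : ℂ} {R : ℝ} (hguard : ∀ u : I, u ≤ v → R < dist (c u) q) :
    c v ∈ farPast (truncate c m) q R := by
  have hmem : (v : ℝ) / m ∈ I :=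
    ⟨div_nonneg v.2.1 hm.le, div_le_one_of_le₀ (Subtype.coe_le_coe.2 hvm) hm.le⟩
  refine ⟨⟨(v : ℝ) / m, hmem⟩, fun u' hu' => ?_, ?_⟩
  · change R < dist (c ⟨(m : ℝ) * u', _⟩) q
    refine hguard _ (Subtype.coe_le_coe.1 ?_)
    change (m : ℝ) * u' ≤ v
    have h := mul_le_mul_of_nonneg_left (Subtype.coe_le_coe.2 hu') hm.le
    rwa [show (m : ℝ) * ((⟨(v : ℝ) / m, hmem⟩ : I) : ℝ) = v from mul_div_cancel₀ _ hm.ne'] at h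
  · change c ⟨(m : ℝ) * ((v : ℝ) / m), _⟩ = c v
    congr 1
    exact Subtype.ext (mul_div_cancel₀ _ hm.ne')

/-! ## The lattice reading of the squeeze configuration -/

section Lattice

variable {Ω : Set ℂ} {δ : ℝ} {u wv : Site 2}

/-- A vertex of the walk `ρ`-close to `q` at or before a given parameter `τ`, found from a polyline
point `ρ₀`-close to `q` at `τ` (`ρ₀ + δ ≤ ρ`): the vertex of the dyadic window of `τ`. [folklore] -/
theorem exists_vertex_mem_closedBall (hδ : 0 < δ) (γ : SAW.DomainSAW Ω δ u wv) {q : ℂ} {ρ ρ₀ : ℝ}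
    (hρ₀ : ρ₀ + δ ≤ ρ) {τ : I} (hτ : dist (latticeCurve γ τ) q < ρ₀) :
    ∃ l : ℕ, l ≤ γ.length ∧ vertexTime l ≤ τ ∧ meshPoint δ (γ.walk.getVert l) ∈ closedBall q ρ := by
  rcases eq_or_lt_of_le τ.2.2 with h1 | h1
  · have hτ1 : τ = 1 := Subtype.ext h1
    refine ⟨γ.walk.length, le_rfl, hτ1 ▸ vertexTime_le_one _, ?_⟩
    rw [hτ1, latticeCurve_one] at hτ
    rw [SimpleGraph.Walk.getVert_length, mem_closedBall]
    linarith
  · obtain ⟨l, hl1, hl2, -⟩ := exists_vertexTime_le τ h1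
    have hd := (dist_latticeCurve_le γ hl1 hl2).1
    rw [abs_of_pos hδ] at hd
    refine ⟨min l γ.walk.length, min_le_right _ _, (vertexTime_mono (min_le_left _ _)).trans hl1, ?_⟩
    have hv : γ.walk.getVert (min l γ.walk.length) = γ.walk.getVert l := by
      rcases le_total l γ.walk.length with h | h
      · rw [min_eq_left h]
      · rw [min_eq_right h, SimpleGraph.Walk.getVert_length, SimpleGraph.Walk.getVert_of_length_le _ h]
    rw [hv, mem_closedBall]
    have h₁ := dist_triangle (meshPoint δ (γ.walk.getVert l)) (latticeCurve γ τ) q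
    rw [dist_comm] at hd
    linarith

/-- A vertex of index `≥ k` within `δ` of the polyline point at a parameter `t'` beyond the vertex
time of `k` (`k ≤ |γ|`): the vertex of the dyadic window of `t'`, capped at `|γ|`. [folklore] -/
theorem exists_vertex_near (hδ : 0 < δ) (γ : SAW.DomainSAW Ω δ u wv) {k : ℕ} (hk : k ≤ γ.length)
    {t' : I} (hkt' : vertexTime k ≤ t') :
    ∃ j : ℕ, k ≤ j ∧ j ≤ γ.length ∧ dist (meshPoint δ (γ.walk.getVert j)) (latticeCurve γ t') ≤ δ := by
  rcases eq_or_lt_of_le t'.2.2 with h1 | h1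
  · have ht1 : t' = 1 := Subtype.ext h1
    refine ⟨γ.walk.length, hk, le_rfl, ?_⟩
    rw [ht1, latticeCurve_one, SimpleGraph.Walk.getVert_length, dist_self]
    exact hδ.le
  · obtain ⟨l, hl1, hl2, hmax⟩ := exists_vertexTime_le t' h1
    have hd := (dist_latticeCurve_le γ hl1 hl2).1
    rw [abs_of_pos hδ, dist_comm] at hd
    refine ⟨min l γ.walk.length, le_min (hmax k hkt') hk, min_le_right _ _, ?_⟩
    have hv : γ.walk.getVert (min l γ.walk.length) = γ.walk.getVert l := by
      rcases le_total l γ.walk.length with h | h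
      · rw [min_eq_left h]
      · rw [min_eq_right h, SimpleGraph.Walk.getVert_length, SimpleGraph.Walk.getVert_of_length_le _ h]
    rwa [hv]

/-- **The lattice reading of the squeeze configuration.** For a lattice SAW `γ` of mesh `δ > 0` whose
mesh polyline is in `Conf q ρ ρ₀ R ε N` with `ρ₀ + δ ≤ ρ`, the index `k` of the first vertex in
`B̄(q, ρ)` satisfies: its prefix polyline (with `k + 1` vertices) has the class of the truncation at
the vertex time `1 - 2^{-k}`, which lies in the squeeze window, so that class is in `N`; and some
vertex of index `j ≥ k` is within `ε + δ` of the `R`-far past of that truncation. [folklore] -/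
theorem latticeEvent_of_conf (hδ : 0 < δ) (γ : SAW.DomainSAW Ω δ u wv) {q : ℂ} {ρ ρ₀ R ε : ℝ}
    {N : Set (CurveClass ℂ)} (hρ₀ : ρ₀ + δ ≤ ρ) (h : Conf q ρ ρ₀ R ε N (latticeCurve γ)) :
    ∃ k : ℕ, k ≤ γ.length ∧ meshPoint δ (γ.walk.getVert k) ∈ closedBall q ρ ∧
      (∀ i : ℕ, i < k → meshPoint δ (γ.walk.getVert i) ∉ closedBall q ρ) ∧
      CurveClass.mk (⟨polyline ((γ.walk.support.take (k + 1)).map (meshPoint δ))⟩ : Curve ℂ) =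
        CurveClass.mk (truncate (latticeCurve γ) (vertexTime k)) ∧
      CurveClass.mk (truncate (latticeCurve γ) (vertexTime k)) ∈ N ∧
      ∃ j : ℕ, k ≤ j ∧ j ≤ γ.length ∧ ∃ x ∈ farPast (truncate (latticeCurve γ) (vertexTime k)) q R,
        dist (meshPoint δ (γ.walk.getVert j)) x < ε + δ := by
  classical
  obtain ⟨v, τa, τb, t', hvτa, -, hτbt, ρ₂, hρ₂, hfar, hτb, hguard, hret, hclause⟩ := h
  -- (A)/(B) the first vertex `k` in the closed ball exists and has vertex time `≤ τb`
  obtain ⟨l₁, hl₁len, hl₁τb, hl₁mem⟩ := exists_vertex_mem_closedBall hδ γ hρ₀ hτb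
  have hex : ∃ k : ℕ, meshPoint δ (γ.walk.getVert k) ∈ closedBall q ρ := ⟨l₁, hl₁mem⟩
  set k := Nat.find hex with hkdef
  have hk : meshPoint δ (γ.walk.getVert k) ∈ closedBall q ρ := Nat.find_spec hex
  have hkmin : ∀ i : ℕ, i < k → meshPoint δ (γ.walk.getVert i) ∉ closedBall q ρ :=
    fun i hi => Nat.find_min hex hi
  have hkl₁ : k ≤ l₁ := Nat.find_le hl₁mem
  have hklen : k ≤ γ.length := hkl₁.trans hl₁len
  have hkτb : vertexTime k ≤ τb := (vertexTime_mono hkl₁).trans hl₁τb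
  -- (C) the vertex time of `k` is after `τa`
  have hτak : τa < vertexTime k := by
    refine lt_of_not_ge fun hle => ?_
    have h₁ := hfar (vertexTime k) hle
    rw [latticeCurve_vertexTime] at h₁
    rw [mem_closedBall] at hk
    linarith
  -- (D) the truncation at the vertex time has class in `N`
  have htrunc : CurveClass.mk (truncate (latticeCurve γ) (vertexTime k)) ∈ N := by
    refine hclause (vertexTime k) hτak.le hkτb ?_
    rw [latticeCurve_vertexTime]
    rw [mem_closedBall] at hk
    linarith
  -- (E) the prefix polyline has the same class
  have hprefix : CurveClass.mk (⟨polyline ((γ.walk.support.take (k + 1)).map (meshPoint δ))⟩ : Curve ℂ)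
      = CurveClass.mk (truncate (latticeCurve γ) (vertexTime k)) := by
    rw [← mk_minCurve_eq_mk_truncate]
    congr 1
    exact Curve.ext (ContinuousMap.ext fun t => polyline_map_take_support γ t hklen)
  -- (F) the returning vertex and the far-past point
  have hkt' : vertexTime k ≤ t' := hkτb.trans hτbt
  obtain ⟨j, hkj, hjlen, hjdist⟩ := exists_vertex_near hδ γ hklen hkt'
  have hx : latticeCurve γ v ∈ farPast (truncate (latticeCurve γ) (vertexTime k)) q R :=
    apply_mem_farPast_truncate (vertexTime_pos_of_lt hτak) (hvτa.trans hτak.le) hguard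
  refine ⟨k, hklen, hk, hkmin, hprefix, htrunc, j, hkj, hjlen, latticeCurve γ v, hx, ?_⟩
  have h₁ := dist_triangle (meshPoint δ (γ.walk.getVert j)) (latticeCurve γ t') (latticeCurve γ v)
  linarith

end Lattice

end Summit.CriticalPhenomena.SAWScalingLimit.Theorems.SimpleSubseqLimits.SlitRestriction.Transfer

end
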